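import Summits.RiemannHypothesis.RiemannHypothesis.Theorems.SuzukiStructureFunctionsWindowFunctional
import Summits.RiemannHypothesis.RiemannHypothesis.Theorems.SuzukiStructureFunctionsHalfPlane
import Summits.RiemannHypothesis.RiemannHypothesis.Theorems.SuzukiStructureFunctionsStructContinuity
import Summits.RiemannHypothesis.RiemannHypothesis.Theorems.SuzukiStructureFunctionsExtendedSystem
import Mathlib.MeasureTheory.Integral.IntervalIntegral.FundThmCalculus
import Mathlib.MeasureTheory.Integral.Bochner.ContinuousLinearMap
import Mathlib.Analysis.Convolution
import HarnessLib

/-!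
# SuzukiStructureFunctionsWindowFourier — the window Fourier formula for `𝔉, 𝔊` on ALL of `ℂ` (Fourier image of
# Prop. 3.1's (3.28)), and the `t`-derivative of the window transforms `P^ε(t,w) = ∫_{(−t,t)} e^{iwy}φ^ε(t,y)dy`:
# `∂_tP^ε = μe^{iwt} − iwP^{−ε} − εμP^ε` for `C¹` kernels (column DBR; RH-FREE)

LINE 1 — LABEL: RH-FREE (Fubini on a compact window, window-functional differentiation, (3.25), integration by parts;
ANY Suzuki pair resp. ANY `C¹` kernel vanishing on `(−∞,0]`; no `ζ`, no zeros, no positivity); bears_on LADDER-RH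
B-D → B-P(P1)/(P3): these are the two inputs from which Thm. 3.1 (4) (the canonical system for `(A(t,z), B(t,z))`)
follows by algebra — see …CanonicalSystem.
WHAT THIS IS NOT: not progress toward RH; the canonical system itself is assembled in the next file.

Source: M. Suzuki, J. Funct. Anal. 281 (2021) 109116 = arXiv:1606.05726 [Suzuki2021Hamiltonians], Prop. 3.1 (3.28),
(3.27), §3.5 (3.25), §3.6 (proof of Thm. 3.1 (4) «by elementary ways»).

Contents (seat rh-dbr-eng-5 g7): **`fourier_window_conv_eq`** (Fubini), **`fourier_frakFG_eq_window`**,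
`setIntegral_Ioo_eq_intervalIntegral_complex`, **`hasDerivAt_window_transform`**.
-/

noncomputable section

-- D-0017: `Summit.<S>.<S>.…` is the designed namespace of a single-problem summit.
set_option linter.dupNamespace false

open MeasureTheory Set Filter Topology Function Complex
open scoped ENNReal RealInnerProductSpace

namespace Summit.RiemannHypothesis.RiemannHypothesis.Theorems.SuzukiStructureFunctions

open Literature.Analysis.OperatorTheory Literature.NumberTheory.LFunctions
  Literature.NumberTheory.LFunctions.SuzukiStructure
open Summit.RiemannHypothesis.RiemannHypothesis.Theorems.SuzukiPhiExistence
  (continuous_suzukiPhiExt exists_isSuzukiPhiSolution_of_noUnitEigenvalue)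

variable {ϱ K : ℝ → ℝ} {ε t : ℝ}

/-! ## §28 The window Fourier formula for `𝔉, 𝔊` (all `z ∈ ℂ`) and the `t`-derivative of the window transforms
`P^ε(t,z) = ∫_{(−t,t)} φ^ε(t,y)e^{izy}dy`: `∂_tP^ε = μe^{izt} − izP^{−ε} − εμP^ε` -/

/-- RH-FREE. **Fubini on a window:** for `ϱ` continuous with super-exponential decay and `φ` continuous,
`𝖥[x ↦ ∫_{(−t,t)} ϱ(x−y)φ(y)dy](z) = 𝖥ϱ(z)·∫_{(−t,t)} φ(y)e^{izy}dy` for EVERY `z ∈ ℂ`, and the Fourier integrand is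
integrable. -/
theorem fourier_window_conv_eq {ϱ φ : ℝ → ℝ} (hρc : Continuous ϱ)
    (hdec : ∀ n : ℝ, ∃ C : ℝ, ∀ x : ℝ, |ϱ x| ≤ C * Real.exp (-(n * |x|))) (hφ : Continuous φ) (t : ℝ) (z : ℂ) :
    Integrable (fun x : ℝ => ((∫ y in Ioo (-t) t, ϱ (x - y) * φ y : ℝ) : ℂ) * cexp (I * z * x)) ∧
      fourier (fun x => ∫ y in Ioo (-t) t, ϱ (x - y) * φ y) z =
        fourier ϱ z * ∫ y in Ioo (-t) t, (φ y : ℂ) * cexp (I * z * y) := by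
  set f : ℝ → ℂ := fun y => (Ioo (-t) t).indicator (fun y => (φ y : ℂ) * cexp (I * z * y)) y with hf
  set g : ℝ → ℂ := fun u => (ϱ u : ℂ) * cexp (I * z * u) with hg
  have hfi : Integrable f :=
    (integrable_indicator_iff measurableSet_Ioo).2
      ((((continuous_ofReal.comp hφ).mul (by fun_prop)).integrableOn_Icc (a := -t) (b := t)).mono_set
        Ioo_subset_Icc_self)
  have hgi : Integrable g := integrable_mul_cexp_of_decay hρc hdec z
  have hH : Integrable (Function.uncurry fun x y : ℝ =>
      ((ϱ (x - y) * (Ioo (-t) t).indicator φ y : ℝ) : ℂ) * cexp (I * z * x)) ((volume : Measure ℝ).prod volume) := by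
    have hconv := hfi.convolution_integrand (ContinuousLinearMap.mul ℂ ℂ) hgi
    refine hconv.congr (Eventually.of_forall fun p => ?_)
    rcases p with ⟨x, y⟩
    simp only [Function.uncurry_apply_pair, ContinuousLinearMap.mul_apply', hf, hg]
    have hexp : cexp (I * z * (y : ℂ)) * cexp (I * z * ((x - y : ℝ) : ℂ)) = cexp (I * z * (x : ℂ)) := by
      rw [← Complex.exp_add, Complex.ofReal_sub]; ring_nf
    by_cases hy : y ∈ Ioo (-t) t
    · rw [indicator_of_mem hy, indicator_of_mem hy, Complex.ofReal_mul]
      calc (φ y : ℂ) * cexp (I * z * (y : ℂ)) * ((ϱ (x - y) : ℂ) * cexp (I * z * ((x - y : ℝ) : ℂ)))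
          = (ϱ (x - y) : ℂ) * (φ y : ℂ) * (cexp (I * z * (y : ℂ)) * cexp (I * z * ((x - y : ℝ) : ℂ))) := by
            ring
        _ = (ϱ (x - y) : ℂ) * (φ y : ℂ) * cexp (I * z * (x : ℂ)) := by rw [hexp]
    · rw [indicator_of_notMem hy, indicator_of_notMem hy]
      simp
  have hW : ∀ x : ℝ, ((∫ y in Ioo (-t) t, ϱ (x - y) * φ y : ℝ) : ℂ) * cexp (I * z * x) =
      ∫ y : ℝ, ((ϱ (x - y) * (Ioo (-t) t).indicator φ y : ℝ) : ℂ) * cexp (I * z * x) := by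
    intro x
    have hcoe : ((∫ y in Ioo (-t) t, ϱ (x - y) * φ y : ℝ) : ℂ) =
        ∫ y : ℝ, ((ϱ (x - y) * (Ioo (-t) t).indicator φ y : ℝ) : ℂ) := by
      rw [← integral_indicator measurableSet_Ioo]
      have e : ((∫ y, (Ioo (-t) t).indicator (fun y => ϱ (x - y) * φ y) y : ℝ) : ℂ) =
          ∫ y, (((Ioo (-t) t).indicator (fun y => ϱ (x - y) * φ y) y : ℝ) : ℂ) := integral_ofReal.symm
      rw [e]
      refine integral_congr_ae (Eventually.of_forall fun y => ?_)
      simp only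
      by_cases hy : y ∈ Ioo (-t) t
      · rw [indicator_of_mem hy, indicator_of_mem hy]
      · rw [indicator_of_notMem hy, indicator_of_notMem hy, mul_zero]
    rw [hcoe, integral_mul_const]
  have hinner : ∀ y : ℝ, ∫ x : ℝ, ((ϱ (x - y) * (Ioo (-t) t).indicator φ y : ℝ) : ℂ) * cexp (I * z * x) =
      (((Ioo (-t) t).indicator φ y : ℝ) : ℂ) * (cexp (I * z * y) * fourier ϱ z) := by
    intro y
    rw [← fourier_comp_sub ϱ y z, fourier_def, ← integral_const_mul]
    refine integral_congr_ae (Eventually.of_forall fun x => ?_)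
    simp only
    push_cast
    ring
  have hint : Integrable (fun x : ℝ => ((∫ y in Ioo (-t) t, ϱ (x - y) * φ y : ℝ) : ℂ) * cexp (I * z * x)) := by
    refine hH.integral_prod_left.congr (Eventually.of_forall fun x => ?_)
    simp only
    exact (hW x).symm
  refine ⟨hint, ?_⟩
  rw [fourier_def]
  simp_rw [hW]
  rw [integral_integral_swap hH]
  simp_rw [hinner]
  have hind : (fun y : ℝ => (((Ioo (-t) t).indicator φ y : ℝ) : ℂ) * (cexp (I * z * y) * fourier ϱ z)) =
      fun y => (Ioo (-t) t).indicator (fun y => (φ y : ℂ) * cexp (I * z * y)) y * fourier ϱ z := by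
    funext y
    by_cases hy : y ∈ Ioo (-t) t
    · rw [indicator_of_mem hy, indicator_of_mem hy]; ring
    · rw [indicator_of_notMem hy, indicator_of_notMem hy]; simp
  rw [hind, integral_mul_const, integral_indicator measurableSet_Ioo]
  ring

/-- **RH-FREE · THE WINDOW FOURIER FORMULA, ALL `z ∈ ℂ`:** on a solvable window,
`𝖥(frakFG ε t)(z) = ½(e^{izt}E(z) + εe^{−izt}E(−z)) − (ε/2)(E(z)P^ε(t,z) + εE(−z)P^ε(t,−z))` with `E = 𝖥ϱ` and the
window transforms `P^ε(t,w) = ∫_{(−t,t)} φ^ε(t,y)e^{iwy}dy` — the Fourier image of Prop. 3.1's first line (3.28)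
(compact window, hence valid on all of `ℂ`, unlike (3.27)₂). -/
theorem fourier_frakFG_eq_window (h : IsSuzukiPair ϱ K) (hsol : ∃ X : ℝ → ℝ, IsSuzukiPhiSolution K ε t X) (z : ℂ) :
    fourier (frakFG ϱ K ε t) z =
      1 / 2 * (cexp (I * z * t) * fourier ϱ z + ε * (cexp (I * (-z) * t) * fourier ϱ (-z))) -
        ε / 2 * (fourier ϱ z * (∫ y in Ioo (-t) t, (suzukiPhiExt K ε t y : ℂ) * cexp (I * z * y)) +
          ε * (fourier ϱ (-z) * ∫ y in Ioo (-t) t, (suzukiPhiExt K ε t y : ℂ) * cexp (I * (-z) * y))) := by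
  have hK3 : ∀ u : ℝ, u < 0 → K u = 0 := fun u hu => h.kernel_eq_zero u hu.le
  set φ := suzukiPhiExt K ε t with hφdef
  have hφc : Continuous φ := continuous_suzukiPhiExt h.continuous_kernel hK3 ε t
  set T : ℝ → ℝ := fun x => ∫ y in Ioo (-t) t, ϱ (x - y) * φ y with hTdef
  -- pointwise representation of `frakFG` through the window
  have hrep : ∀ x : ℝ, frakFG ϱ K ε t x = 1 / 2 * (ϱ (x - t) + ε * ϱ (-x - t)) - ε / 2 * (T x + ε * T (-x)) := by
    intro x
    rw [frakFG_eq_repr h hsol x, setIntegral_Iic_mul_suzukiPhiExt_eq hK3 _ ε t]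
    have hi1 : IntegrableOn (fun y => ϱ (x - y) * φ y) (Ioo (-t) t) :=
      (((h.continuous_rho.comp (continuous_const.sub continuous_id)).mul hφc).integrableOn_Icc).mono_set
        Ioo_subset_Icc_self
    have hi2 : IntegrableOn (fun y => ϱ (-x - y) * φ y) (Ioo (-t) t) :=
      (((h.continuous_rho.comp (continuous_const.sub continuous_id)).mul hφc).integrableOn_Icc).mono_set
        Ioo_subset_Icc_self
    have e : ∫ y in Ioo (-t) t, (ϱ (x - y) + ε * ϱ (-x - y)) * φ y =
        (∫ y in Ioo (-t) t, ϱ (x - y) * φ y) + ε * ∫ y in Ioo (-t) t, ϱ (-x - y) * φ y := by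
      rw [← integral_const_mul, ← integral_add hi1 (hi2.const_mul ε)]
      exact setIntegral_congr_fun measurableSet_Ioo fun y _ => by ring
    rw [e]
  -- integrability of the four Fourier integrands
  have hdec1 : ∀ n : ℝ, ∃ C : ℝ, ∀ x : ℝ, |ϱ (x - t)| ≤ C * Real.exp (-(n * |x|)) := fun n => by
    obtain ⟨C, _, hC⟩ := decay_uniform_shift h.abs_rho_le n |t|
    exact ⟨C, fun x => (hC x t le_rfl).1⟩
  have hdec2 : ∀ n : ℝ, ∃ C : ℝ, ∀ x : ℝ, |ϱ (-x - t)| ≤ C * Real.exp (-(n * |x|)) := fun n => by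
    obtain ⟨C, _, hC⟩ := decay_uniform_shift h.abs_rho_le n |t|
    exact ⟨C, fun x => (hC x t le_rfl).2⟩
  have i1 : Integrable fun x : ℝ => (ϱ (x - t) : ℂ) * cexp (I * z * x) :=
    integrable_mul_cexp_of_decay (h.continuous_rho.comp (continuous_id.sub continuous_const)) hdec1 z
  have i2 : Integrable fun x : ℝ => (ϱ (-x - t) : ℂ) * cexp (I * z * x) :=
    integrable_mul_cexp_of_decay (h.continuous_rho.comp ((continuous_neg).sub continuous_const)) hdec2 z
  obtain ⟨i3, hF3⟩ := fourier_window_conv_eq h.continuous_rho h.abs_rho_le hφc t z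
  obtain ⟨i4', hF4⟩ := fourier_window_conv_eq h.continuous_rho h.abs_rho_le hφc t (-z)
  have i4 : Integrable fun x : ℝ => (T (-x) : ℂ) * cexp (I * z * x) := by
    have e : (fun x : ℝ => (T (-x) : ℂ) * cexp (I * z * x)) =
        fun x : ℝ => (fun u : ℝ => (T u : ℂ) * cexp (I * (-z) * u)) (-x) := by
      funext x
      simp only [hTdef]
      congr 1
      push_cast
      ring_nf
    rw [e]
    exact i4'.comp_neg
  -- the four Fourier transforms
  have hF1 : ∫ x : ℝ, (ϱ (x - t) : ℂ) * cexp (I * z * x) = cexp (I * z * t) * fourier ϱ z := by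
    rw [← fourier_comp_sub ϱ t z, fourier_def]
  have hF2 : ∫ x : ℝ, (ϱ (-x - t) : ℂ) * cexp (I * z * x) = cexp (I * (-z) * t) * fourier ϱ (-z) := by
    rw [← fourier_comp_sub ϱ t (-z), ← fourier_comp_neg, fourier_def]
  have hF4' : ∫ x : ℝ, (T (-x) : ℂ) * cexp (I * z * x) =
      fourier ϱ (-z) * ∫ y in Ioo (-t) t, (φ y : ℂ) * cexp (I * (-z) * y) := by
    rw [← hF4, ← fourier_comp_neg, fourier_def]
  rw [fourier_def] at hF3
  -- assemble
  rw [fourier_def]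
  have hpt : ∀ x : ℝ, (frakFG ϱ K ε t x : ℂ) * cexp (I * z * x) =
      ((1 / 2 : ℂ) * ((ϱ (x - t) : ℂ) * cexp (I * z * x)) + (ε / 2 : ℂ) * ((ϱ (-x - t) : ℂ) * cexp (I * z * x))) -
        ((ε / 2 : ℂ) * ((T x : ℂ) * cexp (I * z * x)) + (ε * ε / 2 : ℂ) * ((T (-x) : ℂ) * cexp (I * z * x))) := by
    intro x
    rw [hrep x]
    push_cast
    ring
  calc ∫ x : ℝ, (frakFG ϱ K ε t x : ℂ) * cexp (I * z * x)
      = ∫ x : ℝ, (((1 / 2 : ℂ) * ((ϱ (x - t) : ℂ) * cexp (I * z * x)) +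
          (ε / 2 : ℂ) * ((ϱ (-x - t) : ℂ) * cexp (I * z * x))) -
          ((ε / 2 : ℂ) * ((T x : ℂ) * cexp (I * z * x)) + (ε * ε / 2 : ℂ) * ((T (-x) : ℂ) * cexp (I * z * x)))) :=
        integral_congr_ae (Eventually.of_forall hpt)
    _ = (∫ x : ℝ, ((1 / 2 : ℂ) * ((ϱ (x - t) : ℂ) * cexp (I * z * x)) +
          (ε / 2 : ℂ) * ((ϱ (-x - t) : ℂ) * cexp (I * z * x)))) -
          ∫ x : ℝ, ((ε / 2 : ℂ) * ((T x : ℂ) * cexp (I * z * x)) +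
            (ε * ε / 2 : ℂ) * ((T (-x) : ℂ) * cexp (I * z * x))) :=
        integral_sub ((i1.const_mul _).add (i2.const_mul _)) ((i3.const_mul _).add (i4.const_mul _))
    _ = ((1 / 2 : ℂ) * (∫ x : ℝ, (ϱ (x - t) : ℂ) * cexp (I * z * x)) +
          (ε / 2 : ℂ) * ∫ x : ℝ, (ϱ (-x - t) : ℂ) * cexp (I * z * x)) -
          ((ε / 2 : ℂ) * (∫ x : ℝ, (T x : ℂ) * cexp (I * z * x)) +
            (ε * ε / 2 : ℂ) * ∫ x : ℝ, (T (-x) : ℂ) * cexp (I * z * x)) := by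
        rw [integral_add (i1.const_mul _) (i2.const_mul _), integral_add (i3.const_mul _) (i4.const_mul _),
          integral_const_mul, integral_const_mul, integral_const_mul, integral_const_mul]
    _ = _ := by
        rw [hF1, hF2, hF3, hF4']
        ring

/-- RH-FREE. Complex-valued window set integrals as interval integrals (`t ≥ 0`). -/
theorem setIntegral_Ioo_eq_intervalIntegral_complex (ht : 0 ≤ t) (f : ℝ → ℂ) :
    ∫ y in Ioo (-t) t, f y = ∫ y in (-t)..t, f y := by
  rw [intervalIntegral.integral_of_le (by linarith), setIntegral_congr_set (Ioo_ae_eq_Ioc (μ := volume))]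

/-- **RH-FREE · THE WINDOW TRANSFORMS `P^ε(t,w) = ∫_{(−t,t)} e^{iwy}φ^ε(t,y)dy` SATISFY
`∂_tP^ε = μ(t)e^{iwt} − iwP^{−ε} − εμ(t)P^ε`** (`K ∈ C¹` vanishing on `(−∞,0]`, clean `t ∈ (0,τ)`, every `w ∈ ℂ`):
window-functional differentiation (…WindowFunctional), the first-order system (3.25) (…PhiSystem) and an integration by
parts on `[−t,t]` (`φ^{−ε}(t,−t) = 0`). -/
theorem hasDerivAt_window_transform (hKd : ContDiff ℝ 1 K) (hK0 : ∀ u : ℝ, u ≤ 0 → K u = 0) (hε : ε = 1 ∨ ε = -1)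
    {τ : ℝ} (hclean : ∀ s : ℝ, s ∈ Ico 0 τ → NoUnitEigenvalue K s) (ht : t ∈ Ioo 0 τ) (w : ℂ) :
    HasDerivAt (fun s : ℝ => ∫ y in Ioo (-s) s, cexp (I * w * y) * (suzukiPhiExt K ε s y : ℂ))
      ((mu K t : ℂ) * cexp (I * w * t) -
        I * w * (∫ y in Ioo (-t) t, cexp (I * w * y) * (suzukiPhiExt K (-ε) t y : ℂ)) -
        ε * mu K t * ∫ y in Ioo (-t) t, cexp (I * w * y) * (suzukiPhiExt K ε t y : ℂ)) t := by
  have ht0 : 0 ≤ t := ht.1.le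
  have hN : NoUnitEigenvalue K t := hclean t ⟨ht0, ht.2⟩
  have hKc : Continuous K := hKd.continuous
  have hK3 : ∀ u : ℝ, u < 0 → K u = 0 := fun u hu => hK0 u hu.le
  have hε' : -ε = 1 ∨ -ε = -1 := by
    rcases hε with h | h
    · exact Or.inr (by rw [h])
    · exact Or.inl (by rw [h]; norm_num)
  have hsol' : ∃ X, IsSuzukiPhiSolution K (-ε) t X := exists_isSuzukiPhiSolution_of_noUnitEigenvalue hKc hK0 hε' hN
  set φ := suzukiPhiExt K ε t with hφdef
  set φ' := suzukiPhiExt K (-ε) t with hφ'def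
  set χ := deriv (suzukiPhiExt K (-ε) t) with hχdef
  have hφc : Continuous φ := continuous_suzukiPhiExt hKc hK3 ε t
  have hφ'c : Continuous φ' := continuous_suzukiPhiExt hKc hK3 (-ε) t
  have hχc : Continuous χ := continuous_deriv_suzukiPhiExt_space hKd hK0 hsol' ht0
  have hg : Continuous fun y : ℝ => cexp (I * w * y) := by fun_prop
  have h1 := hasDerivAt_window_functional_complex hKd hK0 hε hclean ht hg
  refine h1.congr_deriv ?_
  -- (3.25): `∂_tφ^ε(t,y) = ∂_yφ^{−ε}(t,y) − εμ(t)φ^ε(t,y)`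
  have h325 : ∀ y : ℝ, deriv (fun s : ℝ => suzukiPhiExt K ε s y) t = χ y - ε * mu K t * φ y := by
    intro y
    have h := deriv_time_add_mu_mul_eq_deriv_space hKd hK0 hε hclean ht y
    rw [← hχdef] at h
    linarith
  simp_rw [h325]
  have hiχ : IntegrableOn (fun y : ℝ => cexp (I * w * y) * (χ y : ℂ)) (Ioo (-t) t) :=
    ((hg.mul (continuous_ofReal.comp hχc)).integrableOn_Icc).mono_set Ioo_subset_Icc_self
  have hiφ : IntegrableOn (fun y : ℝ => cexp (I * w * y) * (φ y : ℂ)) (Ioo (-t) t) :=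
    ((hg.mul (continuous_ofReal.comp hφc)).integrableOn_Icc).mono_set Ioo_subset_Icc_self
  have hsplit : ∫ y in Ioo (-t) t, cexp (I * w * y) * ((χ y - ε * mu K t * φ y : ℝ) : ℂ) =
      (∫ y in Ioo (-t) t, cexp (I * w * y) * (χ y : ℂ)) -
        ε * mu K t * ∫ y in Ioo (-t) t, cexp (I * w * y) * (φ y : ℂ) := by
    rw [← integral_const_mul, ← integral_sub hiχ (hiφ.const_mul _)]
    refine setIntegral_congr_fun measurableSet_Ioo fun y _ => ?_
    push_cast
    ring
  -- integration by parts for the `χ`-term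
  have hneg : φ' (-t) = 0 := suzukiPhiExt_neg_self hK0 hsol'
  have hdφ' : ∀ y : ℝ, HasDerivAt (fun y : ℝ => (φ' y : ℂ)) ((χ y : ℝ) : ℂ) y := fun y =>
    ((hasDerivAt_suzukiPhiExt_space hKd hK0 hsol' y).differentiableAt.hasDerivAt).ofReal_comp
  have hp := intervalIntegral.integral_mul_deriv_eq_deriv_mul (a := -t) (b := t)
    (u := fun y : ℝ => cexp (I * w * y)) (u' := fun y : ℝ => I * w * cexp (I * w * y))
    (v := fun y : ℝ => (φ' y : ℂ)) (v' := fun y : ℝ => ((χ y : ℝ) : ℂ))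
    (fun y _ => hasDerivAt_cexp_I_mul_ofReal w y) (fun y _ => hdφ' y)
    ((by fun_prop : Continuous fun y : ℝ => I * w * cexp (I * w * y)).intervalIntegrable _ _)
    ((continuous_ofReal.comp hχc).intervalIntegrable _ _)
  have hparts : ∫ y in Ioo (-t) t, cexp (I * w * y) * (χ y : ℂ) =
      cexp (I * w * t) * (φ' t : ℂ) - I * w * ∫ y in Ioo (-t) t, cexp (I * w * y) * (φ' y : ℂ) := by
    rw [setIntegral_Ioo_eq_intervalIntegral_complex ht0, setIntegral_Ioo_eq_intervalIntegral_complex ht0, hp,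
      hneg, ← intervalIntegral.integral_const_mul]
    push_cast
    rw [mul_zero, sub_zero]
    congr 1
    refine intervalIntegral.integral_congr fun y _ => ?_
    ring
  have hmu : mu K t = φ t + φ' t := by
    rw [mu_def, hφdef, hφ'def]
    rcases hε with h | h
    · rw [h]
    · rw [h, neg_neg, add_comm]
  rw [hsplit, hparts, hmu]
  push_cast
  ring

end Summit.RiemannHypothesis.RiemannHypothesis.Theorems.SuzukiStructureFunctions
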